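import Summits.QuantumFields.YangMills.Theorems.CurvatureBoostCovariance.Negative.Unbundled
import Summits.QuantumFields.YangMills.Theorems.NPointIsotropy.Negative.NPointRegularJunk
import Summits.QuantumFields.YangMills.Theorems.MirrorModularBoostsCurvatureBoostCovarianceTensorDensity
import Summits.QuantumFields.YangMills.Theorems.MirrorModularBoostsCurvatureBoostCovarianceDoubledToInvariant
import Summits.QuantumFields.YangMills.Theorems.MirrorModularBoostsCurvatureBoostCovarianceRayPositivity
import Summits.QuantumFields.YangMills.Theorems.MirrorModularBoostsCurvatureBoostCovarianceLevelGrowthLow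
import Summits.QuantumFields.YangMills.Theorems.MirrorModularBoostsCurvatureBoostCovarianceParitySieve
import Summits.QuantumFields.YangMills.Theorems.MirrorModularBoostsPlanarSpectralCone
import Summits.QuantumFields.YangMills.Theorems.PencilRigidityShellRigidity
import Summits.QuantumFields.YangMills.Theorems.MirrorModularBoostsSoftKernelBoostCovarianceLaurentLayers
import Summits.QuantumFields.YangMills.Theorems.MirrorModularBoostsSoftKernelBoostCovarianceLevelGrowthHighOfBoostType
import Summits.QuantumFields.YangMills.Theorems.MirrorModularBoostsSoftKernelBoostCovarianceOrbitBandlimitLocal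
import Summits.QuantumFields.YangMills.Theorems.MirrorModularBoostsSoftKernelBoostCovarianceRayPositivityLocal
import Summits.QuantumFields.YangMills.Theorems.MirrorModularBoostsSoftKernelBoostCovarianceConeFamily
import Summits.QuantumFields.YangMills.Theorems.MirrorModularBoostsSoftKernelBoostCovarianceAsmUniformBoost
import Summits.QuantumFields.YangMills.Theorems.MirrorModularBoostsSoftKernelBoostCovarianceAsmTypedBoost
import Summits.QuantumFields.YangMills.Theorems.SoftKernelBoostCovariance.Negative.TieLoadBearing
import Summits.QuantumFields.YangMills.Theorems.PencilRigidityNPointIsotropyCoreCertificate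

/-!
# The crux `SoftKernelBoostCovariance` from its two Yang–Mills inputs — the landed composition of line `Sketch`

Line `Sketch` of crux `MirrorModularBoosts.SoftKernelBoostCovariance` (stmt-QuantumFields-14999; route-QuantumFields-MirrorModularBoosts):
the composition `SoftKernelBoostCovariance_of` of the registered skeleton `Cruxes/SoftKernelBoostCovariance/Lines/Sketch.lean` (v3.5) with its
two remaining sorry-backed stubs — the Yang–Mills inputs Step 0 (`stub_tieRegularity`) and Σ (`stub_sandwichBound`) — turned into
HYPOTHESES, so that the whole model-blind line is an importable, kernel-checked theorem:

    stub_cruxOfInputs : (Step 0) → (Σ) → Summit.QuantumFields.YangMills.Theses.MirrorModularBoosts.SoftKernelBoostCovariance.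

Everything it uses is landed (p-ids in the line card `Cruxes/SoftKernelBoostCovariance/Lines/Sketch.md`); this file only re-assembles
them (the helpers below are the skeleton's, verbatim).  Use: a planner who files Step 0 and Σ as items closes the re-lined engine by
`exact stub_cruxOfInputs h0 hΣ`.
-/

noncomputable section

namespace Summit.QuantumFields.YangMills.Theorems.SoftKernelBoostCovariance.Sketch

open scoped BigOperators SchwartzMap InnerProductSpace
open MeasureTheory Filter Topology
open Literature.MathematicalPhysics.QuantumLattice Literature.MathematicalPhysics.AQFT
  Literature.MathematicalPhysics.QuantumFieldTheory
open Summit.QuantumFields.YangMills.Theorems.NPointIsotropy.Negative (E4 NPointRegular)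
open Summit.QuantumFields.YangMills.Theorems.CurvatureBoostCovariance.Negative
  (OSPackage Translations Hypercubic EightFrameRP PlanarCone PlanarInvariant Tie Gaps W1)
open Summit.QuantumFields.YangMills.Theorems.CurvatureBoostCovariance.BoostsInheritMirrors
  (stub_orbitBandlimit stub_rayPositivity stub_doubledToInvariant stub_tensorDensity stub_paritySieve
    trigPoly_coeff_eq_zero_of_const)
open Summit.QuantumFields.YangMills.Theorems.CurvatureBoostCovariance.BoostsInheritMirrors.RayPositivity
  (pencil_eq_inner orbit_eq_inner osReconstruction_of exists_isTimeOrdered_planeRot translations_pullBack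
    isSymmetric_pullBack hasLinearGrowth_pullBack isReflectionPositive_pullBack eightFrameRP_pullBack planarCone_pullBack)

/-- **The sandwich bound is monotone in the exponent for reserves `≤ 1`**: the bound with exponent `μ` implies the bound
with exponent `max μ 0` (same constant), because `u ^ (-μ) ≤ u ^ (-max μ 0)` for `0 < u ≤ 1` (and a negative right-hand side
is absurd against a norm). Used to run the chain with a nonnegative type. -/
theorem sandwich_mono_exponent {S : LabelledSchwingerFamily Unit E4} (h : OSReconstructionNoE1 S) {μ C : ℝ}
    (hS : ∀ (u v : ℝ), 0 < u → 0 < v → u ≤ 1 → v ≤ 1 →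
           ∀ (f₁ : SchwartzMap (Fin 1 → E4) ℂ) (g hh : ℝ × ℝ → ℂ) (Mg Mh Mh' : ℝ),
             (∀ x : Fin 1 → E4, f₁ x = g (x 0 0, x 0 1) * hh (x 0 2, x 0 3)) →
             (∀ p : ℝ × ℝ, g p ≠ 0 → u ≤ p.1 ∧ p.1 ≤ 2 * u) →
             MeasureTheory.Integrable g → (∫ p, ‖g p‖) ≤ Mg →
             MeasureTheory.Integrable hh → (∫ p, ‖hh p‖) ≤ Mh → (∀ p, ‖hh p‖ ≤ Mh') →
           ∀ (n : ℕ) (W : SchwartzMap (Fin n → E4) ℂ) (hW : IsTimeOrdered W)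
             (hFW : IsTimeOrdered
               (SchwartzMap.appendTensor f₁ (translateMulti ((2 * u + v) • EuclideanSpace.single 0 1) W))),
             ‖h.fieldVec (1 + n) (fun _ => ())
                 (SchwartzMap.appendTensor f₁ (translateMulti ((2 * u + v) • EuclideanSpace.single 0 1) W)) hFW‖
               ≤ C * Mg * (Mh + Mh') * (u ^ (-μ) + v ^ (-μ)) * ‖h.fieldVec n (fun _ => ()) W hW‖) :
    ∀ (u v : ℝ), 0 < u → 0 < v → u ≤ 1 → v ≤ 1 →
           ∀ (f₁ : SchwartzMap (Fin 1 → E4) ℂ) (g hh : ℝ × ℝ → ℂ) (Mg Mh Mh' : ℝ),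
             (∀ x : Fin 1 → E4, f₁ x = g (x 0 0, x 0 1) * hh (x 0 2, x 0 3)) →
             (∀ p : ℝ × ℝ, g p ≠ 0 → u ≤ p.1 ∧ p.1 ≤ 2 * u) →
             MeasureTheory.Integrable g → (∫ p, ‖g p‖) ≤ Mg →
             MeasureTheory.Integrable hh → (∫ p, ‖hh p‖) ≤ Mh → (∀ p, ‖hh p‖ ≤ Mh') →
           ∀ (n : ℕ) (W : SchwartzMap (Fin n → E4) ℂ) (hW : IsTimeOrdered W)
             (hFW : IsTimeOrdered
               (SchwartzMap.appendTensor f₁ (translateMulti ((2 * u + v) • EuclideanSpace.single 0 1) W))),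
             ‖h.fieldVec (1 + n) (fun _ => ())
                 (SchwartzMap.appendTensor f₁ (translateMulti ((2 * u + v) • EuclideanSpace.single 0 1) W)) hFW‖
               ≤ C * Mg * (Mh + Mh') * (u ^ (-max μ 0) + v ^ (-max μ 0)) * ‖h.fieldVec n (fun _ => ()) W hW‖ := by
  intro u v hu hv hu1 hv1 f₁ g hh Mg Mh Mh' hf hg hgi hgM hhi hhM hhM' n W hW hFW
  have h0 := hS u v hu hv hu1 hv1 f₁ g hh Mg Mh Mh' hf hg hgi hgM hhi hhM hhM' n W hW hFW
  have hpow : u ^ (-μ) + v ^ (-μ) ≤ u ^ (-max μ 0) + v ^ (-max μ 0) :=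
    add_le_add (Real.rpow_le_rpow_of_exponent_ge hu hu1 (neg_le_neg (le_max_left μ 0)))
      (Real.rpow_le_rpow_of_exponent_ge hv hv1 (neg_le_neg (le_max_left μ 0)))
  have hpos : 0 < u ^ (-μ) + v ^ (-μ) := add_pos (Real.rpow_pos_of_pos hu _) (Real.rpow_pos_of_pos hv _)
  set P := C * Mg * (Mh + Mh') with hP
  set X := ‖h.fieldVec n (fun _ => ()) W hW‖ with hX
  have hX0 : 0 ≤ X := norm_nonneg _
  rcases le_or_gt 0 (P * X) with hPX | hPX
  · calc _ ≤ P * (u ^ (-μ) + v ^ (-μ)) * X := h0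
      _ = (P * X) * (u ^ (-μ) + v ^ (-μ)) := by ring
      _ ≤ (P * X) * (u ^ (-max μ 0) + v ^ (-max μ 0)) := mul_le_mul_of_nonneg_left hpow hPX
      _ = P * (u ^ (-max μ 0) + v ^ (-max μ 0)) * X := by ring
  · exfalso
    have h1 : P * (u ^ (-μ) + v ^ (-μ)) * X < 0 := by
      have : P * (u ^ (-μ) + v ^ (-μ)) * X = (P * X) * (u ^ (-μ) + v ^ (-μ)) := by ring
      rw [this]; exact mul_neg_of_neg_of_pos hPX hpos
    exact absurd (h0.trans_lt h1) (not_lt.2 (norm_nonneg _))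

/-- Uniform boost vectors imply the non-uniform form (pure logic). -/
theorem boostVectors_of_uniform {S₁ : SchwingerFamily E4} (h : OSReconstructionNoE1 S₁.toLabelled)
    (hu : ∀ (n : ℕ), ∃ N : ℝ, ∀ (F : SchwartzMap (Fin n → E4) ℂ), IsTimeOrdered F →
          HasCompactSupport (F : (Fin n → E4) → ℂ) →
          ∃ ε : ℝ, 0 < ε ∧ ∃ (V : ℂ → h.Hilbert) (C : ℝ),
            DifferentiableOn ℂ V {θ : ℂ | |θ.re| < ε} ∧
            (∀ θ : ℂ, |θ.re| < ε → ‖V θ‖ ≤ C * Real.exp (N * |θ.im|)) ∧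
            ∀ θ : ℝ, |θ| < ε → ∀ hθ : IsTimeOrdered (linActMulti (planeRot (0 : Fin 3) θ) F),
              V θ = h.fieldVec n (fun _ => ()) (linActMulti (planeRot (0 : Fin 3) θ) F) hθ) :
    ∀ (n : ℕ) (F : SchwartzMap (Fin n → E4) ℂ), IsTimeOrdered F →
          HasCompactSupport (F : (Fin n → E4) → ℂ) →
          ∃ ε : ℝ, 0 < ε ∧ ∃ (V : ℂ → h.Hilbert) (C N : ℝ),
            DifferentiableOn ℂ V {θ : ℂ | |θ.re| < ε} ∧
            (∀ θ : ℂ, |θ.re| < ε → ‖V θ‖ ≤ C * Real.exp (N * |θ.im|)) ∧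
            ∀ θ : ℝ, |θ| < ε → ∀ hθ : IsTimeOrdered (linActMulti (planeRot (0 : Fin 3) θ) F),
              V θ = h.fieldVec n (fun _ => ()) (linActMulti (planeRot (0 : Fin 3) θ) F) hθ := by
  intro n F hF hFc
  obtain ⟨N, hN⟩ := hu n
  obtain ⟨ε, hε, V, C, hd, hg, hv⟩ := hN F hF hFc
  exact ⟨ε, hε, V, C, N, hd, hg, hv⟩

/-- **The model-blind sieve, LOCAL form**: for a one-species family with the OS package, translations, proper hypercubic invariance,
the eight frames and the planar cone, IF every `𝔖ₙ|⁰𝒮` is a function, the doubled orbit functions are trigonometric polynomials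
(Stub 3ℓ instantiated), the pencils are PSD on `ℝ∖0` (Stub 4ℓ instantiated) and the level growth holds at every level, then `S₁` is
planar-invariant on `⁰𝒮` (landed Stubs 6, 6a and the parity sieve; induction on the OS level — verbatim the parent's argument). -/
theorem sieve_of_stubs (S₁ : SchwingerFamily E4) (hOS : OSPackage S₁) (htr : Translations S₁) (hreg : NPointRegular S₁)
    (hband : ∀ (n m : ℕ) (F : 𝓢((Fin n → E4), ℂ)) (G : 𝓢((Fin m → E4), ℂ)),
        IsTimeOrdered F → IsTimeOrdered G →
        HasCompactSupport (F : (Fin n → E4) → ℂ) → HasCompactSupport (G : (Fin m → E4) → ℂ) →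
        ∀ H : 𝓢((Fin (n + m) → E4), ℂ), IsAppendTensorOf H (osAdjoint F) G →
          ∃ (K : ℕ) (c : ℤ → ℂ), ∀ θ : ℝ,
            S₁ (n + m) (linActMulti (planeRot (0 : Fin 3) θ) H) =
              ∑ k ∈ Finset.Icc (-(K : ℤ)) K, c k * Complex.exp (4 * (k : ℂ) * (θ : ℂ) * Complex.I))
    (hpos : ∀ (n m : ℕ) (F : 𝓢((Fin n → E4), ℂ)) (G : 𝓢((Fin m → E4), ℂ)),
        IsTimeOrdered F → IsTimeOrdered G →
        HasCompactSupport (F : (Fin n → E4) → ℂ) → HasCompactSupport (G : (Fin m → E4) → ℂ) →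
        ∀ (HFF : 𝓢((Fin (n + n) → E4), ℂ)) (HFG : 𝓢((Fin (n + m) → E4), ℂ))
          (HGF : 𝓢((Fin (m + n) → E4), ℂ)) (HGG : 𝓢((Fin (m + m) → E4), ℂ)),
          IsAppendTensorOf HFF (osAdjoint F) F → IsAppendTensorOf HFG (osAdjoint F) G →
          IsAppendTensorOf HGF (osAdjoint G) F → IsAppendTensorOf HGG (osAdjoint G) G →
        ∀ (Kp Kq Kq' Kr : ℕ) (p q q' r : ℤ → ℂ),
          (∀ θ : ℝ, S₁ (n + n) (linActMulti (planeRot (0 : Fin 3) θ) HFF) =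
            ∑ k ∈ Finset.Icc (-(Kp : ℤ)) Kp, p k * Complex.exp (4 * (k : ℂ) * (θ : ℂ) * Complex.I)) →
          (∀ θ : ℝ, S₁ (n + m) (linActMulti (planeRot (0 : Fin 3) θ) HFG) =
            ∑ k ∈ Finset.Icc (-(Kq : ℤ)) Kq, q k * Complex.exp (4 * (k : ℂ) * (θ : ℂ) * Complex.I)) →
          (∀ θ : ℝ, S₁ (m + n) (linActMulti (planeRot (0 : Fin 3) θ) HGF) =
            ∑ k ∈ Finset.Icc (-(Kq' : ℤ)) Kq', q' k * Complex.exp (4 * (k : ℂ) * (θ : ℂ) * Complex.I)) →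
          (∀ θ : ℝ, S₁ (m + m) (linActMulti (planeRot (0 : Fin 3) θ) HGG) =
            ∑ k ∈ Finset.Icc (-(Kr : ℤ)) Kr, r k * Complex.exp (4 * (k : ℂ) * (θ : ℂ) * Complex.I)) →
        ∀ s : ℝ, s ≠ 0 → ∀ v w : ℂ,
          (fun z : ℂ => 0 ≤ z.re ∧ z.im = 0)
            ((∑ k ∈ Finset.Icc (-(Kp : ℤ)) Kp, starRingEnd ℂ v * v * (p k * (s : ℂ) ^ k)) +
            (∑ k ∈ Finset.Icc (-(Kq : ℤ)) Kq, starRingEnd ℂ v * w * (q k * (s : ℂ) ^ k)) +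
            (∑ k ∈ Finset.Icc (-(Kq' : ℤ)) Kq', starRingEnd ℂ w * v * (q' k * (s : ℂ) ^ k)) +
            (∑ k ∈ Finset.Icc (-(Kr : ℤ)) Kr, starRingEnd ℂ w * w * (r k * (s : ℂ) ^ k))))
    (hgrow : ∀ a : ℕ,
      (∀ N : ℕ, N + 2 ≤ 2 * a → ∀ R : E4 ≃ₗᵢ[ℝ] E4,
            LinearMap.det (R.toLinearEquiv : E4 →ₗ[ℝ] E4) = 1 →
            R (EuclideanSpace.single 2 1) = EuclideanSpace.single 2 1 →
            R (EuclideanSpace.single 3 1) = EuclideanSpace.single 3 1 →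
            ∀ F : SchwartzMap (Fin N → E4) ℂ, IsOffDiagonal F → S₁ N (linActMulti R F) = S₁ N F) →
      ∀ (F : 𝓢((Fin a → E4), ℂ)), IsTimeOrdered F → HasCompactSupport (F : (Fin a → E4) → ℂ) →
      ∀ H : 𝓢((Fin (a + a) → E4), ℂ), IsAppendTensorOf H (osAdjoint F) F →
      ∀ (K : ℕ) (p : ℤ → ℂ),
        (∀ θ : ℝ, S₁ (a + a) (linActMulti (planeRot (0 : Fin 3) θ) H) =
          ∑ k ∈ Finset.Icc (-(K : ℤ)) K, p k * Complex.exp (4 * (k : ℂ) * (θ : ℂ) * Complex.I)) →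
        ∀ k ∈ Finset.Icc (-(K : ℤ)) K, 2 ≤ |k| → p k = 0) :
    PlanarInvariant S₁ := by
  have hd2i := stub_doubledToInvariant stub_tensorDensity S₁ hOS htr hreg
  -- one level of the induction: invariance below `2a - 1` ⇒ doubled-orbit constancy up to level `a`
  have level_step : ∀ a : ℕ,
      (∀ N : ℕ, N + 2 ≤ 2 * a → ∀ R : E4 ≃ₗᵢ[ℝ] E4,
            LinearMap.det (R.toLinearEquiv : E4 →ₗ[ℝ] E4) = 1 →
            R (EuclideanSpace.single 2 1) = EuclideanSpace.single 2 1 →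
            R (EuclideanSpace.single 3 1) = EuclideanSpace.single 3 1 →
            ∀ F : SchwartzMap (Fin N → E4) ℂ, IsOffDiagonal F → S₁ N (linActMulti R F) = S₁ N F) →
      ∀ n m : ℕ, n ≤ a → m ≤ a →
        ∀ (F : 𝓢((Fin n → E4), ℂ)) (G : 𝓢((Fin m → E4), ℂ)),
          IsTimeOrdered F → IsTimeOrdered G →
          HasCompactSupport (F : (Fin n → E4) → ℂ) → HasCompactSupport (G : (Fin m → E4) → ℂ) →
          ∀ H : 𝓢((Fin (n + m) → E4), ℂ), IsAppendTensorOf H (osAdjoint F) G →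
            ∀ θ : ℝ, S₁ (n + m) (linActMulti (planeRot (0 : Fin 3) θ) H) = S₁ (n + m) H := by
    intro a hInv n m hn hm F G hF hG hFc hGc H hH θ
    obtain ⟨HFF, hHFF⟩ := exists_isAppendTensorOf (osAdjoint F) F
    obtain ⟨HGF, hHGF⟩ := exists_isAppendTensorOf (osAdjoint G) F
    obtain ⟨HGG, hHGG⟩ := exists_isAppendTensorOf (osAdjoint G) G
    obtain ⟨Kp, p, hp⟩ := hband n n F F hF hF hFc hFc HFF hHFF
    obtain ⟨Kq, q, hq⟩ := hband n m F G hF hG hFc hGc H hH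
    obtain ⟨Kq', q', hq'⟩ := hband m n G F hG hF hGc hFc HGF hHGF
    obtain ⟨Kr, r, hr⟩ := hband m m G G hG hG hGc hGc HGG hHGG
    have hpsd := hpos n m F G hF hG hFc hGc HFF H HGF HGG hHFF hH hHGF hHGG Kp Kq Kq' Kr p q q' r hp hq hq' hr
    have hp2 : ∀ k ∈ Finset.Icc (-(Kp : ℤ)) Kp, 2 ≤ |k| → p k = 0 :=
      hgrow n (fun N hN => hInv N (by omega)) F hF hFc HFF hHFF Kp p hp
    have hr2 : ∀ k ∈ Finset.Icc (-(Kr : ℤ)) Kr, 2 ≤ |k| → r k = 0 :=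
      hgrow m (fun N hN => hInv N (by omega)) G hG hGc HGG hHGG Kr r hr
    have hq0 : ∀ k ∈ Finset.Icc (-(Kq : ℤ)) Kq, k ≠ 0 → q k = 0 :=
      stub_paritySieve Kp Kq Kq' Kr p q q' r hpsd hp2 hr2
    calc S₁ (n + m) (linActMulti (planeRot (0 : Fin 3) θ) H)
        = ∑ k ∈ Finset.Icc (-(Kq : ℤ)) Kq, q k * Complex.exp (4 * (k : ℂ) * (θ : ℂ) * Complex.I) := hq θ
      _ = ∑ k ∈ Finset.Icc (-(Kq : ℤ)) Kq,
            q k * Complex.exp (4 * (k : ℂ) * ((0 : ℝ) : ℂ) * Complex.I) := by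
          refine Finset.sum_congr rfl fun k hk => ?_
          by_cases hk0 : k = 0
          · subst hk0; simp
          · rw [hq0 k hk hk0]; simp
      _ = S₁ (n + m) (linActMulti (planeRot (0 : Fin 3) 0) H) := (hq 0).symm
      _ = S₁ (n + m) H := by rw [Summit.QuantumFields.YangMills.Theorems.NPointIsotropy.ComplexRotationBandlimit.linActMulti_planeRot_angle_zero]
  have hQ : ∀ a n m : ℕ, n ≤ a → m ≤ a →
      ∀ (F : 𝓢((Fin n → E4), ℂ)) (G : 𝓢((Fin m → E4), ℂ)),
        IsTimeOrdered F → IsTimeOrdered G →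
        HasCompactSupport (F : (Fin n → E4) → ℂ) → HasCompactSupport (G : (Fin m → E4) → ℂ) →
        ∀ H : 𝓢((Fin (n + m) → E4), ℂ), IsAppendTensorOf H (osAdjoint F) G →
          ∀ θ : ℝ, S₁ (n + m) (linActMulti (planeRot (0 : Fin 3) θ) H) = S₁ (n + m) H := by
    intro a
    induction a with
    | zero => exact level_step 0 fun N hN => absurd hN (by omega)
    | succ a ih => exact level_step (a + 1) fun N hN => hd2i a ih N (by omega)
  intro R hdet h2 h3 N F hF
  exact hd2i N (hQ N) N (by omega) R hdet h2 h3 F hF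

/-- **Level growth at levels `a ≤ 1` from the KERNEL TRIPLE of `S₁` itself** (sorry-free: the triple + the landed
`KernelTransfer` + the LANDED `ShellRigidity_proof` make the two-point kernel radial, so the degree-`2` doubled orbit is
constant and its non-zero layers vanish; `a = 0` is trivial). -/
theorem levelGrowthLow_of_kernel
    {G : Type} [Group G] [TopologicalSpace G] [IsTopologicalGroup G] [CompactSpace G] [MeasurableSpace G] [BorelSpace G]
    {r : LatticeRep G} {sch : SpeciesScheme (YMSpecies G)} {S₁ : SchwingerFamily E4}
    (hW : W1 r sch S₁) (h8 : EightFrameRP S₁)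
    (hK : ∃ (K : E4 → ℝ) (C η : ℝ), 0 < η ∧ ContinuousOn K {x : E4 | x ≠ 0} ∧
      (∀ x : E4, x ≠ 0 → |K x| ≤ C * (1 + ‖x‖ ^ (η - 10))) ∧
      ∀ F : 𝓢((Fin 2 → E4), ℂ), IsOffDiagonal F →
        MeasureTheory.Integrable (fun x : Fin 2 → E4 => (K (x 0 - x 1) : ℂ) * F x) ∧
          S₁ 2 F = ∫ x : Fin 2 → E4, (K (x 0 - x 1) : ℂ) * F x) :
    ∀ a : ℕ, a ≤ 1 →
      ∀ (F : 𝓢((Fin a → E4), ℂ)), IsTimeOrdered F →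
      ∀ H : 𝓢((Fin (a + a) → E4), ℂ), IsAppendTensorOf H (osAdjoint F) F →
      ∀ (K : ℕ) (p : ℤ → ℂ),
        (∀ θ : ℝ, S₁ (a + a) (linActMulti (planeRot (0 : Fin 3) θ) H) =
          ∑ k ∈ Finset.Icc (-(K : ℤ)) K, p k * Complex.exp (4 * (k : ℂ) * (θ : ℂ) * Complex.I)) →
        ∀ k ∈ Finset.Icc (-(K : ℤ)) K, 2 ≤ |k| → p k = 0 := by
  intro a ha F hF H hH K p hp
  have hconst : ∀ θ : ℝ, S₁ (a + a) (linActMulti (planeRot (0 : Fin 3) θ) H) = S₁ (a + a) H := by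
    obtain rfl | rfl : a = 0 ∨ a = 1 := by omega
    · intro θ
      congr 1
      ext x
      rw [linActMulti_apply]
      congr 1
      funext i
      exact Fin.elim0 i
    · obtain ⟨Kf, C, η, hη, hKc, hKb, hKrep⟩ := hK
      obtain ⟨-, hOS, -, hhyp, -⟩ := hW
      obtain ⟨hWB4, hax, hdiag⟩ :=
        Summit.QuantumFields.YangMills.Theorems.KernelTransfer.kernelTransfer_proof S₁ Kf hKc hKrep hOS.2.2.2.2.1 hhyp h8
      have hrad : Summit.QuantumFields.YangMills.Theorems.NPointIsotropy.Negative.RadialKernel S₁ :=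
        ⟨Kf, hKc, fun R x hx =>
          Summit.QuantumFields.YangMills.Cruxes.ShellRigidity.TransverseSmearingPlanarThreshold.ShellRigidity_proof
            Kf hKc ⟨C, η, hη, hKb⟩ hWB4 hax hdiag R x hx, hKrep⟩
      have hHoff : IsOffDiagonal H := hH.isOffDiagonal_of_isTimeOrdered hF hF
      intro θ
      exact Summit.QuantumFields.YangMills.Theorems.NPointIsotropy.Negative.radialKernel_invariant_two hrad
        (planeRot (0 : Fin 3) θ) H hHoff
  intro k hk hk2
  have hk0 : k ≠ 0 := by
    rintro rfl
    rw [abs_zero] at hk2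
    exact absurd hk2 (by norm_num)
  exact trigPoly_coeff_eq_zero_of_const K p (S₁ (a + a) H) (fun θ => (hp θ).symm.trans (hconst θ)) k hk hk0

/-- **THE CRUX FROM ITS TWO YANG–MILLS INPUTS (registered `stub_cruxOfInputs`; the whole model-blind line, landed).**
`MirrorModularBoosts.SoftKernelBoostCovariance` (stmt-QuantumFields-14999) follows from Step 0 (densities of `𝔖ₙ|⁰𝒮`:
`W1 → EightFrameRP → PlanarCone → NPointRegular`) and the sandwich bound Σ (for `S₁` and its `45°` pull-back).  Proof: the
`e₀`-reconstructions of `S₁` and of its `45°` pull-back (`osReconstruction_of`, the landed `RayPositivity.*_pullBack` lemmas,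
`PlanarSpectralCone_of`); their cone families (`stub_coneFamily`); Σ made nonnegative in the exponent (`sandwich_mono_exponent`);
uniform boost vectors (`stub_asmUniformBoost`) for both families and type `max μ 0 < 4` under the induction hypothesis
(`stub_asmTypedBoost`); band limit (`stub_orbitBandlimitLocal`), ray positivity (`stub_rayPositivityLocal`); level growth: `a ≤ 1`
from the kernel triple (`levelGrowthLow_of_kernel`), `a ≥ 2` from the type (`stub_levelGrowthHigh_of_boostType`,
`stub_laurentLayers`); the parity sieve (`sieve_of_stubs`). -/
theorem stub_cruxOfInputs :
    open Literature.MathematicalPhysics.QuantumLattice Literature.MathematicalPhysics.AQFT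
      Literature.MathematicalPhysics.QuantumFieldTheory
      Summit.QuantumFields.YangMills.Theorems.CurvatureBoostCovariance.Negative
      Summit.QuantumFields.YangMills.Theorems.NPointIsotropy.Negative in
    (    ∀ (G : Type) [Group G] [TopologicalSpace G] [IsTopologicalGroup G] [CompactSpace G]
       [MeasurableSpace G] [BorelSpace G], IsCompactSimpleLieGroup G →
       ∀ (r : LatticeRep G) (sch : SpeciesScheme (YMSpecies G)) (S₁ : SchwingerFamily E4),
         W1 r sch S₁ → EightFrameRP S₁ → PlanarCone S₁ → NPointRegular S₁) →
    (    ∀ (G : Type) [Group G] [TopologicalSpace G] [IsTopologicalGroup G] [CompactSpace G]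
       [MeasurableSpace G] [BorelSpace G], IsCompactSimpleLieGroup G →
       ∀ (r : LatticeRep G) (sch : SpeciesScheme (YMSpecies G)) (S₁ : SchwingerFamily E4),
         W1 r sch S₁ → EightFrameRP S₁ → PlanarCone S₁ →
         (∃ (K : E4 → ℝ) (C η : ℝ), 0 < η ∧ ContinuousOn K {x : E4 | x ≠ 0} ∧
           (∀ x : E4, x ≠ 0 → |K x| ≤ C * (1 + ‖x‖ ^ (η - 10))) ∧
           ∀ F : SchwartzMap (Fin 2 → E4) ℂ, IsOffDiagonal F →
             MeasureTheory.Integrable (fun x : Fin 2 → E4 => (K (x 0 - x 1) : ℂ) * F x) ∧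
               S₁ 2 F = ∫ x : Fin 2 → E4, (K (x 0 - x 1) : ℂ) * F x) →
         (∀ (h : OSReconstructionNoE1 S₁.toLabelled), ∃ μ C : ℝ, μ < 4 ∧
           (∀ (u v : ℝ), 0 < u → 0 < v → u ≤ 1 → v ≤ 1 →
              ∀ (f₁ : SchwartzMap (Fin 1 → E4) ℂ) (g hh : ℝ × ℝ → ℂ) (Mg Mh Mh' : ℝ),
                (∀ x : Fin 1 → E4, f₁ x = g (x 0 0, x 0 1) * hh (x 0 2, x 0 3)) →
                (∀ p : ℝ × ℝ, g p ≠ 0 → u ≤ p.1 ∧ p.1 ≤ 2 * u) →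
                MeasureTheory.Integrable g → (∫ p, ‖g p‖) ≤ Mg →
                MeasureTheory.Integrable hh → (∫ p, ‖hh p‖) ≤ Mh → (∀ p, ‖hh p‖ ≤ Mh') →
              ∀ (n : ℕ) (W : SchwartzMap (Fin n → E4) ℂ) (hW : IsTimeOrdered W)
                (hFW : IsTimeOrdered
                  (SchwartzMap.appendTensor f₁ (translateMulti ((2 * u + v) • EuclideanSpace.single 0 1) W))),
                ‖h.fieldVec (1 + n) (fun _ => ())
                    (SchwartzMap.appendTensor f₁ (translateMulti ((2 * u + v) • EuclideanSpace.single 0 1) W)) hFW‖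
                  ≤ C * Mg * (Mh + Mh') * (u ^ (-μ) + v ^ (-μ)) * ‖h.fieldVec n (fun _ => ()) W hW‖)) ∧
         (∀ (h' : OSReconstructionNoE1 (SchwingerFamily.toLabelled
             (fun n => (S₁ n).comp (linActMulti (planeRot (0 : Fin 3) (Real.pi / 4)))))),
           ∃ μ C : ℝ, μ < 4 ∧
           (∀ (u v : ℝ), 0 < u → 0 < v → u ≤ 1 → v ≤ 1 →
              ∀ (f₁ : SchwartzMap (Fin 1 → E4) ℂ) (g hh : ℝ × ℝ → ℂ) (Mg Mh Mh' : ℝ),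
                (∀ x : Fin 1 → E4, f₁ x = g (x 0 0, x 0 1) * hh (x 0 2, x 0 3)) →
                (∀ p : ℝ × ℝ, g p ≠ 0 → u ≤ p.1 ∧ p.1 ≤ 2 * u) →
                MeasureTheory.Integrable g → (∫ p, ‖g p‖) ≤ Mg →
                MeasureTheory.Integrable hh → (∫ p, ‖hh p‖) ≤ Mh → (∀ p, ‖hh p‖ ≤ Mh') →
              ∀ (n : ℕ) (W : SchwartzMap (Fin n → E4) ℂ) (hW : IsTimeOrdered W)
                (hFW : IsTimeOrdered
                  (SchwartzMap.appendTensor f₁ (translateMulti ((2 * u + v) • EuclideanSpace.single 0 1) W))),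
                ‖h'.fieldVec (1 + n) (fun _ => ())
                    (SchwartzMap.appendTensor f₁ (translateMulti ((2 * u + v) • EuclideanSpace.single 0 1) W)) hFW‖
                  ≤ C * Mg * (Mh + Mh') * (u ^ (-μ) + v ^ (-μ)) * ‖h'.fieldVec n (fun _ => ()) W hW‖))) →
    Summit.QuantumFields.YangMills.Theses.MirrorModularBoosts.SoftKernelBoostCovariance := by
  intro h0 hSig0
  rw [Summit.QuantumFields.YangMills.Theorems.SoftKernelBoostCovariance.Negative.softKernelBoostCovariance_iff]
  intro G _ _ _ _ hG
  letI : MeasurableSpace G := borel G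
  haveI : BorelSpace G := ⟨rfl⟩
  intro r sch S₁ hW h8 hC hK
  have hreg : NPointRegular S₁ := h0 G hG r sch S₁ hW h8 hC
  have hlow := levelGrowthLow_of_kernel hW h8 hK
  obtain ⟨_, hOS, htr, hhyp, -⟩ := id hW
  have hlg := hOS.2.2.1
  have hRP := hOS.2.2.2.1
  have hsym := hOS.2.2.2.2.1
  -- the two reconstructions
  have h : OSReconstructionNoE1 S₁.toLabelled := osReconstruction_of hRP htr
  have hT : OSReconstructionNoE1 (SchwingerFamily.toLabelled (fun n => (S₁ n).comp (linActMulti (planeRot (0 : Fin 3) (Real.pi / 4))))) :=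
    osReconstruction_of (isReflectionPositive_pullBack h8) (translations_pullBack htr _)
  have hPSC : Summit.QuantumFields.YangMills.Theses.MirrorModularBoosts.PlanarSpectralCone :=
    Summit.QuantumFields.YangMills.Cruxes.PlanarSpectralCone.PositivityDiscToOperatorCone.PlanarSpectralCone_of
  -- cone families
  have hN := stub_coneFamily S₁ h hlg hsym htr h8
  have hNT := stub_coneFamily (fun n => (S₁ n).comp (linActMulti (planeRot (0 : Fin 3) (Real.pi / 4)))) hT (hasLinearGrowth_pullBack hlg _) (isSymmetric_pullBack hsym _)
    (translations_pullBack htr _) (eightFrameRP_pullBack h8)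
  -- the sandwich bounds (the YM input), exponents made nonnegative (`sandwich_mono_exponent`)
  obtain ⟨hSig, hSigT⟩ := hSig0 G hG r sch S₁ hW h8 hC hK
  obtain ⟨μ₀, Cμ, hμ₀, hS₀⟩ := hSig h
  obtain ⟨μT₀, CμT, -, hST₀⟩ := hSigT hT
  have hS := sandwich_mono_exponent h hS₀
  have hST := sandwich_mono_exponent hT hST₀
  have hμ : max μ₀ 0 < 4 := max_lt hμ₀ (by norm_num)
  -- the chain, for `S₁` and for `T`
  have huni := stub_asmUniformBoost S₁ h hlg hsym htr h8 hC hN (max μ₀ 0) Cμ hS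
  have hsub := stub_asmTypedBoost S₁ h hlg hsym htr h8 hC hN (max μ₀ 0) Cμ hS (le_max_right _ _)
  have huniT := stub_asmUniformBoost (fun n => (S₁ n).comp (linActMulti (planeRot (0 : Fin 3) (Real.pi / 4)))) hT
    (hasLinearGrowth_pullBack hlg _) (isSymmetric_pullBack hsym _) (translations_pullBack htr _) (eightFrameRP_pullBack h8)
    (planarCone_pullBack hPSC hlg hsym htr h8) hNT (max μT₀ 0) CμT hST
  -- band limit and ray positivity from the local stubs
  have hband := stub_orbitBandlimitLocal S₁ hOS htr hhyp h8 hC hreg (fun _ => huni)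
  have hpos := stub_rayPositivityLocal S₁ hOS htr h8 (fun _ => boostVectors_of_uniform h huni)
    (fun _ => boostVectors_of_uniform hT huniT)
  -- level growth at every level
  have hgrow : ∀ a : ℕ,
      (∀ N : ℕ, N + 2 ≤ 2 * a → ∀ R : E4 ≃ₗᵢ[ℝ] E4,
            LinearMap.det (R.toLinearEquiv : E4 →ₗ[ℝ] E4) = 1 →
            R (EuclideanSpace.single 2 1) = EuclideanSpace.single 2 1 →
            R (EuclideanSpace.single 3 1) = EuclideanSpace.single 3 1 →
            ∀ F : SchwartzMap (Fin N → E4) ℂ, IsOffDiagonal F → S₁ N (linActMulti R F) = S₁ N F) →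
      ∀ (F : 𝓢((Fin a → E4), ℂ)), IsTimeOrdered F → HasCompactSupport (F : (Fin a → E4) → ℂ) →
      ∀ H : 𝓢((Fin (a + a) → E4), ℂ), IsAppendTensorOf H (osAdjoint F) F →
      ∀ (K : ℕ) (p : ℤ → ℂ),
        (∀ θ : ℝ, S₁ (a + a) (linActMulti (planeRot (0 : Fin 3) θ) H) =
          ∑ k ∈ Finset.Icc (-(K : ℤ)) K, p k * Complex.exp (4 * (k : ℂ) * (θ : ℂ) * Complex.I)) →
        ∀ k ∈ Finset.Icc (-(K : ℤ)) K, 2 ≤ |k| → p k = 0 := by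
    intro a hInv F hF hFc H hH K p hp
    by_cases ha : a ≤ 1
    · exact hlow a ha F hF H hH K p hp
    · obtain ⟨ε, hε, V, C', hVd, hVg, hVeq⟩ := hsub a (by omega) hInv F hF hFc
      exact stub_levelGrowthHigh_of_boostType stub_laurentLayers S₁ h a F hF hFc
        ⟨ε, hε, V, C', max μ₀ 0, hμ, hVd, hVg, hVeq⟩ H hH K p hp
  exact sieve_of_stubs S₁ hOS htr hreg hband hpos hgrow


end Summit.QuantumFields.YangMills.Theorems.SoftKernelBoostCovariance.Sketch

end
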